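import Literature.AlgebraicGeometry.Deformation.SmoothLiftAtlasVocabularyQuot
import HarnessLib

/-!
# The Čech 2-cocycle of the indexed lifted atlas ([Hartshorne2010] proof of Thm. 10.2 (a); [Oort1971] §2.2)

Layer `Literature/AlgebraicGeometry/Deformation`, namespace `Literature.AlgebraicGeometry.Deformation.AtlasQuot` (continued).
PROOF FILE, THEOREMS ONLY (no definition, no instance, no notation, no named fact, no `sorry`).  Sequel head (ii) of the (U-glob) organ
(cell `hodgecm-mathlib`, P6b, desk ruling R8 «universal form»; count-neutral), on the VOCABULARY `SmoothLiftAtlasVocabularyQuot` (the shared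
indexed-atlas block: charts `chartLift`, gluings `gluingOn`, discrepancies `disc`, abstract closed fibres `B, π, g`, `readingAut`).

* `reading_restrict_face` — EXISTENCE DIRECTION: a reading `ε` of the three face gluings restricted to a deeper principal open `W′` restricts the
  face reading `δ` (`ε (x|) = (δ x)|`; ★ (c4) `reading_discrepancy_naturality`, intertwiners = the canonical restrictions of (U-can)).
* `reading_of_square` — UNIVERSAL DIRECTION: conversely ANY derivation `ε` on `B W′` with the square `ε (x|) = (δ x)|` IS the reading of the
  restricted gluings (`readingAut … ε = ψ_{ab}| ≫ ψ_{bd}| ≫ ψ_{ad}|⁻¹`): ★ (χ4) `autOfClosedFibreDerivation_comp` + ★ (U-coc) `map_discrepancy`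
  + (U-can) `algHom_ext_restrict` (maps out of `L(r a, res_{W′})` are determined on the image of `L(r a, res_{face})`).
* **`cech_cocycle`** (R8 universal form) — for indices `j l m n`, face readings `δ_{jlm}, δ_{jln}, δ_{jmn}` (chart `j`), `δ_{lmn}` (chart `l`)
  (`readingAut … δ = disc …`) and ANY derivations `ε_face` on `B W₄`, `W₄ = V j ⊓ V l ⊓ V m ⊓ V n`, satisfying the four restriction squares:
  `ε_{lmn} − ε_{jmn} + ε_{jln} − ε_{jlm} = 0` (★ (U-coc) `reading_cocycle` on the four chart lifts over `W₄` and the six canonically restricted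
  gluings) — token-for-token the hypothesis block the κ-class consumer ((vii-b), ★ `cechMD2_eq_zero_of_rep`) asks for.

HC_CM is proved only modulo the printed citations until rung 0 closes; nothing here bears on a summit statement.

## References
* [Hartshorne2010] R. Hartshorne, *Deformation Theory*, GTM 257, Springer (2010): Thm. 10.2 (a) and its proof (p. 81).
* [Oort1971] F. Oort, *Finite group schemes, local moduli for abelian varieties, and lifting problems*, Compositio Math. 23 (1971),
  §2.2 (pp. 277–279).
* [StacksProject] The Stacks Project, Tag 01I2 (sections over a basic open of an affine are a localisation), Tag 00CP.
-/

noncomputable section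

-- `TopCat.Presheaf`/`TopCat.Sheaf` are not reducible (as in Mathlib's `AlgebraicGeometry/Modules`).
set_option backward.isDefEq.respectTransparency false

open CategoryTheory AlgebraicGeometry Opposite TopologicalSpace
open scoped TensorProduct

universe u

namespace Literature.AlgebraicGeometry.Deformation.AtlasQuot

open Literature.AlgebraicGeometry.Deformation.CanonicalLiftQuot Literature.AlgebraicGeometry.Deformation.ExtensionAutomorphismsQuot
  Literature.AlgebraicGeometry.Deformation.LiftObstructionCocycleQuot Literature.AlgebraicGeometry.Deformation.LiftGluingSuppliersQuot

variable {A' : Type u} [CommRing A'] {X₀ : Scheme.{u}} [instΓ : ∀ W : X₀.Opens, Algebra A' Γ(X₀, W)]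
  (halg : ∀ (W V : X₀.Opens) (e : V ≤ W) (a : A'), X₀.presheaf.map (homOfLE e).op (algebraMap A' Γ(X₀, W) a) = algebraMap A' Γ(X₀, V) a)

section Atlas

variable {J : Ideal A'} (hJ : IsNilpotent J) {ι : Type*} (V : ι → X₀.affineOpens) (c : (a b : ι) → Γ(X₀, (V a).1))
  (hc : ∀ a b, (V a).1 ⊓ (V b).1 = X₀.basicOpen (c a b))
  {P : ι → Type u} [∀ a, CommRing (P a)] [∀ a, Algebra A' (P a)]
  (r : (a : ι) → P a →ₐ[A'] Γ(X₀, (V a).1)) (hr : ∀ a, Function.Surjective (r a))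
  (hkr : ∀ a, RingHom.ker (r a) = J.map (algebraMap A' (P a)))
  (ψ : (a b : ι) → chartLift V r a (inf_le_left : (V a).1 ⊓ (V b).1 ≤ (V a).1) ≃ₐ[A']
    chartLift V r b (inf_le_right : (V a).1 ⊓ (V b).1 ≤ (V b).1))
  (hψ : ∀ a b x, reduction (r b) (res (inf_le_right : (V a).1 ⊓ (V b).1 ≤ (V b).1)) (halg _ _ _) (ψ a b x) =
    reduction (r a) (res (inf_le_left : (V a).1 ⊓ (V b).1 ≤ (V a).1)) (halg _ _ _) x)
  (𝔪 : Ideal A') (h𝔪J : 𝔪 * J = ⊥) (hJ𝔪 : J ≤ 𝔪) {B : X₀.Opens → Type u} [∀ W, CommRing (B W)] [∀ W, Algebra A' (B W)]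
  (π : (W : X₀.Opens) → Γ(X₀, W) →ₐ[A'] B W)
  (hπ : ∀ (a : ι) (W : X₀.Opens), W ≤ (V a).1 → (∃ q : Γ(X₀, (V a).1), W = X₀.basicOpen q) →
    Function.Surjective (π W) ∧ RingHom.ker (π W) = 𝔪.map (algebraMap A' Γ(X₀, W)))
  (g : ∀ ⦃W W' : X₀.Opens⦄, W' ≤ W → (B W →ₐ[A'] B W'))
  (hg : ∀ ⦃W W' : X₀.Opens⦄ (h : W' ≤ W) (x : Γ(X₀, W)), g h (π W x) = π W' (res h x)) [∀ a, Module.Flat A' (P a)]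

/-! ## §1 A face reading restricts (existence direction) -/

include hc hg in
/-- **A face reading restricts** («naturally isomorphic»): if `δ` reads the discrepancy `disc a b d` on the triple overlap and `ε` reads the
discrepancy of the SAME three gluings restricted to a deeper principal open `W′`, then `ε (x|) = (δ x)|` — ★ (c4) `reading_discrepancy_naturality`
with the canonical restrictions of (U-can) as intertwiners (`gluingOn_naturality`, `fibreRed_restrict`).
[cite: Hartshorne2010, Thm. 10.2 (a) (proof), p. 81] [cite: Oort1971, §2.2 (pp. 277–279)] -/
theorem reading_restrict_face (a b d : ι) (W' : X₀.Opens) (ha' : W' ≤ (V a).1) (hb' : W' ≤ (V b).1) (hd' : W' ≤ (V d).1)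
    (hW' : W' ≤ (V a).1 ⊓ (V b).1 ⊓ (V d).1) (pa : ∃ q : Γ(X₀, (V a).1), W' = X₀.basicOpen q)
    (pb : ∃ q : Γ(X₀, (V b).1), W' = X₀.basicOpen q) (pd : ∃ q : Γ(X₀, (V d).1), W' = X₀.basicOpen q)
    {δ : Derivation A' (B ((V a).1 ⊓ (V b).1 ⊓ (V d).1)) (B ((V a).1 ⊓ (V b).1 ⊓ (V d).1) ⊗[A'] ↥J)}
    (hδ : readingAut halg hJ V r hr hkr 𝔪 π hπ h𝔪J hJ𝔪 a (inf_le_left.trans inf_le_left) ⟨_, inf₃_eq_basicOpen₁ V c hc a b d⟩ δ =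
      disc halg hJ V c hc r hr hkr ψ hψ a b d)
    {ε : Derivation A' (B W') (B W' ⊗[A'] ↥J)}
    (hε : readingAut halg hJ V r hr hkr 𝔪 π hπ h𝔪J hJ𝔪 a ha' pa ε =
        (gluingOn halg hJ V r hr hkr ψ hψ a b W' ha' hb' pa pb).trans
          ((gluingOn halg hJ V r hr hkr ψ hψ b d W' hb' hd' pb pd).trans (gluingOn halg hJ V r hr hkr ψ hψ a d W' ha' hd' pa pd).symm))
    (x : B ((V a).1 ⊓ (V b).1 ⊓ (V d).1)) :
    ε (g hW' x) = LinearMap.rTensor ↥J (g hW').toLinearMap (δ x) := by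
  haveI hflat : ∀ (e : ι) (W : X₀.Opens) (h : W ≤ (V e).1), Module.Flat A' (chartLift V r e h) :=
    fun e W h => CanonicalLiftQuot.flat (r e) (res h)
  exact reading_discrepancy_naturality 𝔪 J h𝔪J hJ𝔪 _ _ _ (fibreRed halg V r π a ha')
    (fibreRed_surjective halg hJ V r hr hkr 𝔪 π hπ a ha' pa) (ker_fibreRed halg hJ V r hr hkr 𝔪 π hπ hJ𝔪 a ha' pa)
    (restrict (r a) (res (inf_le_left.trans inf_le_left : (V a).1 ⊓ (V b).1 ⊓ (V d).1 ≤ (V a).1)) (res ha')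
      (liftSubmonoid_mono _ _ _ (res hW') fun q => res_res (inf_le_left.trans inf_le_left) hW' q))
    (restrict (r b) (res (inf_le_left.trans inf_le_right : (V a).1 ⊓ (V b).1 ⊓ (V d).1 ≤ (V b).1)) (res hb')
      (liftSubmonoid_mono _ _ _ (res hW') fun q => res_res (inf_le_left.trans inf_le_right) hW' q))
    (restrict (r d) (res (inf_le_right : (V a).1 ⊓ (V b).1 ⊓ (V d).1 ≤ (V d).1)) (res hd')
      (liftSubmonoid_mono _ _ _ (res hW') fun q => res_res inf_le_right hW' q))
    (g hW') (fun y => fibreRed_restrict halg V r π g hg a (inf_le_left.trans inf_le_left) hW' y)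
    _ _ _ (gluingOn halg hJ V r hr hkr ψ hψ a b W' ha' hb' pa pb) (gluingOn halg hJ V r hr hkr ψ hψ b d W' hb' hd' pb pd)
    (gluingOn halg hJ V r hr hkr ψ hψ a d W' ha' hd' pa pd)
    (fun y => gluingOn_naturality halg hJ V r hr hkr ψ hψ a b _ W' (inf_le_left.trans inf_le_left) (inf_le_left.trans inf_le_right) hW'
      ha' hb' ⟨_, inf₃_eq_basicOpen₁ V c hc a b d⟩ ⟨_, inf₃_eq_basicOpen₂ V c hc a b d⟩ pa pb y)
    (fun y => gluingOn_naturality halg hJ V r hr hkr ψ hψ b d _ W' (inf_le_left.trans inf_le_right) inf_le_right hW'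
      hb' hd' ⟨_, inf₃_eq_basicOpen₂ V c hc a b d⟩ ⟨_, inf₃_eq_basicOpen₃ V c hc a b d⟩ pb pd y)
    (fun y => gluingOn_naturality halg hJ V r hr hkr ψ hψ a d _ W' (inf_le_left.trans inf_le_left) inf_le_right hW'
      ha' hd' ⟨_, inf₃_eq_basicOpen₁ V c hc a b d⟩ ⟨_, inf₃_eq_basicOpen₃ V c hc a b d⟩ pa pd y)
    hδ hε x

/-! ## §2 A derivation satisfying the restriction square IS the reading (universal direction) -/

include hc hg in
/-- **Squares pin readings:** if `δ` reads `disc a b d` and `ε` on `B W′` satisfies `ε (x|) = (δ x)|`, then `ε` READS the discrepancy of the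
three gluings restricted to `W′`.  Proof: `θ_ε ∘ f = f ∘ θ_δ` (★ (χ4) `autOfClosedFibreDerivation_comp`), `f ∘ disc = disc′ ∘ f`
(★ `map_discrepancy` with `gluingOn_naturality`), and maps out of `L(r a, res_{W′})` are determined on the image of the face lift
((U-can) `algHom_ext_restrict`). [cite: Hartshorne2010, Thm. 10.2 (a) (proof), p. 81] [cite: Oort1971, §2.2 (pp. 277–279)] -/
theorem reading_of_square (a b d : ι) (W' : X₀.Opens) (ha' : W' ≤ (V a).1) (hb' : W' ≤ (V b).1) (hd' : W' ≤ (V d).1)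
    (hW' : W' ≤ (V a).1 ⊓ (V b).1 ⊓ (V d).1) (pa : ∃ q : Γ(X₀, (V a).1), W' = X₀.basicOpen q)
    (pb : ∃ q : Γ(X₀, (V b).1), W' = X₀.basicOpen q) (pd : ∃ q : Γ(X₀, (V d).1), W' = X₀.basicOpen q)
    {δ : Derivation A' (B ((V a).1 ⊓ (V b).1 ⊓ (V d).1)) (B ((V a).1 ⊓ (V b).1 ⊓ (V d).1) ⊗[A'] ↥J)}
    (hδ : readingAut halg hJ V r hr hkr 𝔪 π hπ h𝔪J hJ𝔪 a (inf_le_left.trans inf_le_left) ⟨_, inf₃_eq_basicOpen₁ V c hc a b d⟩ δ =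
      disc halg hJ V c hc r hr hkr ψ hψ a b d)
    {ε : Derivation A' (B W') (B W' ⊗[A'] ↥J)} (hε : ∀ x, ε (g hW' x) = LinearMap.rTensor ↥J (g hW').toLinearMap (δ x)) :
    readingAut halg hJ V r hr hkr 𝔪 π hπ h𝔪J hJ𝔪 a ha' pa ε =
      (gluingOn halg hJ V r hr hkr ψ hψ a b W' ha' hb' pa pb).trans
        ((gluingOn halg hJ V r hr hkr ψ hψ b d W' hb' hd' pb pd).trans (gluingOn halg hJ V r hr hkr ψ hψ a d W' ha' hd' pa pd).symm) := by
  haveI hflat : ∀ (e : ι) (W : X₀.Opens) (h : W ≤ (V e).1), Module.Flat A' (chartLift V r e h) :=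
    fun e W h => CanonicalLiftQuot.flat (r e) (res h)
  refine AlgEquiv.coe_toAlgHom_injective (algHom_ext_restrict (r a)
    (res (inf_le_left.trans inf_le_left : (V a).1 ⊓ (V b).1 ⊓ (V d).1 ≤ (V a).1)) (res ha')
    (liftSubmonoid_mono _ _ _ (res hW') fun q => res_res (inf_le_left.trans inf_le_left) hW' q) _ _ fun x => ?_)
  rw [AlgEquiv.coe_toAlgHom, AlgEquiv.coe_toAlgHom]
  -- `θ_ε (x|) = (θ_δ x)|`
  have step := autOfClosedFibreDerivation_comp 𝔪 J h𝔪J hJ𝔪 (fibreRed halg V r π a (inf_le_left.trans inf_le_left))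
    (fibreRed_surjective halg hJ V r hr hkr 𝔪 π hπ a _ ⟨_, inf₃_eq_basicOpen₁ V c hc a b d⟩)
    (ker_fibreRed halg hJ V r hr hkr 𝔪 π hπ hJ𝔪 a _ ⟨_, inf₃_eq_basicOpen₁ V c hc a b d⟩)
    (fibreRed halg V r π a ha') (fibreRed_surjective halg hJ V r hr hkr 𝔪 π hπ a ha' pa) (ker_fibreRed halg hJ V r hr hkr 𝔪 π hπ hJ𝔪 a ha' pa)
    (restrict (r a) (res (inf_le_left.trans inf_le_left : (V a).1 ⊓ (V b).1 ⊓ (V d).1 ≤ (V a).1)) (res ha')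
      (liftSubmonoid_mono _ _ _ (res hW') fun q => res_res (inf_le_left.trans inf_le_left) hW' q))
    (g hW') (fun y => fibreRed_restrict halg V r π g hg a (inf_le_left.trans inf_le_left) hW' y) δ ε hε x
  -- `(θ_δ x)| = (disc x)| = disc′ (x|)`
  have hdisc := congrArg (fun e : _ ≃ₐ[A'] _ =>
    restrict (r a) (res (inf_le_left.trans inf_le_left : (V a).1 ⊓ (V b).1 ⊓ (V d).1 ≤ (V a).1)) (res ha')
      (liftSubmonoid_mono _ _ _ (res hW') fun q => res_res (inf_le_left.trans inf_le_left) hW' q) (e x)) hδ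
  refine step.symm.trans (hdisc.trans ?_)
  exact map_discrepancy
    (restrict (r a) (res (inf_le_left.trans inf_le_left : (V a).1 ⊓ (V b).1 ⊓ (V d).1 ≤ (V a).1)) (res ha')
      (liftSubmonoid_mono _ _ _ (res hW') fun q => res_res (inf_le_left.trans inf_le_left) hW' q))
    (restrict (r b) (res (inf_le_left.trans inf_le_right : (V a).1 ⊓ (V b).1 ⊓ (V d).1 ≤ (V b).1)) (res hb')
      (liftSubmonoid_mono _ _ _ (res hW') fun q => res_res (inf_le_left.trans inf_le_right) hW' q))
    (restrict (r d) (res (inf_le_right : (V a).1 ⊓ (V b).1 ⊓ (V d).1 ≤ (V d).1)) (res hd')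
      (liftSubmonoid_mono _ _ _ (res hW') fun q => res_res inf_le_right hW' q))
    _ _ _ (gluingOn halg hJ V r hr hkr ψ hψ a b W' ha' hb' pa pb) (gluingOn halg hJ V r hr hkr ψ hψ b d W' hb' hd' pb pd)
    (gluingOn halg hJ V r hr hkr ψ hψ a d W' ha' hd' pa pd)
    (fun y => gluingOn_naturality halg hJ V r hr hkr ψ hψ a b _ W' (inf_le_left.trans inf_le_left) (inf_le_left.trans inf_le_right) hW'
      ha' hb' ⟨_, inf₃_eq_basicOpen₁ V c hc a b d⟩ ⟨_, inf₃_eq_basicOpen₂ V c hc a b d⟩ pa pb y)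
    (fun y => gluingOn_naturality halg hJ V r hr hkr ψ hψ b d _ W' (inf_le_left.trans inf_le_right) inf_le_right hW'
      hb' hd' ⟨_, inf₃_eq_basicOpen₂ V c hc a b d⟩ ⟨_, inf₃_eq_basicOpen₃ V c hc a b d⟩ pb pd y)
    (fun y => gluingOn_naturality halg hJ V r hr hkr ψ hψ a d _ W' (inf_le_left.trans inf_le_left) inf_le_right hW'
      ha' hd' ⟨_, inf₃_eq_basicOpen₁ V c hc a b d⟩ ⟨_, inf₃_eq_basicOpen₃ V c hc a b d⟩ pa pd y) x

/-! ## §3 The Čech 2-cocycle identity (universal form, R8) -/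

include hc hg in
/-- **THE OBSTRUCTION READINGS FORM A ČECH 2-COCYCLE** («the `δ_{ijk}` satisfy the cocycle condition»), universal form: for indices
`j l m n`, face readings `δ` (`readingAut … δ = disc …`; faces `jlm, jln, jmn` read on chart `j`, `lmn` on chart `l`) and ANY derivations
`ε_face` on the closed fibre `B W₄` of `W₄ = V j ⊓ V l ⊓ V m ⊓ V n` satisfying the restriction squares `ε (x|) = (δ x)|`, one has
`ε_{lmn} − ε_{jmn} + ε_{jln} − ε_{jlm} = 0` (the `ε`'s ARE the readings on `W₄` by `reading_of_square`; then ★ (U-coc) `reading_cocycle`).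
[cite: Hartshorne2010, Thm. 10.2 (a) (proof), p. 81] [cite: Oort1971, §2.2 (pp. 277–279)] -/
theorem cech_cocycle (j l m n : ι)
    (hj₄ : (V j).1 ⊓ (V l).1 ⊓ (V m).1 ⊓ (V n).1 ≤ (V j).1) (hl₄ : (V j).1 ⊓ (V l).1 ⊓ (V m).1 ⊓ (V n).1 ≤ (V l).1)
    (hm₄ : (V j).1 ⊓ (V l).1 ⊓ (V m).1 ⊓ (V n).1 ≤ (V m).1) (hn₄ : (V j).1 ⊓ (V l).1 ⊓ (V m).1 ⊓ (V n).1 ≤ (V n).1)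
    (h₄jlm : (V j).1 ⊓ (V l).1 ⊓ (V m).1 ⊓ (V n).1 ≤ (V j).1 ⊓ (V l).1 ⊓ (V m).1)
    (h₄jln : (V j).1 ⊓ (V l).1 ⊓ (V m).1 ⊓ (V n).1 ≤ (V j).1 ⊓ (V l).1 ⊓ (V n).1)
    (h₄jmn : (V j).1 ⊓ (V l).1 ⊓ (V m).1 ⊓ (V n).1 ≤ (V j).1 ⊓ (V m).1 ⊓ (V n).1)
    (h₄lmn : (V j).1 ⊓ (V l).1 ⊓ (V m).1 ⊓ (V n).1 ≤ (V l).1 ⊓ (V m).1 ⊓ (V n).1)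
    {δjlm : Derivation A' (B ((V j).1 ⊓ (V l).1 ⊓ (V m).1)) (B ((V j).1 ⊓ (V l).1 ⊓ (V m).1) ⊗[A'] ↥J)}
    (hδjlm : readingAut halg hJ V r hr hkr 𝔪 π hπ h𝔪J hJ𝔪 j (inf_le_left.trans inf_le_left) ⟨_, inf₃_eq_basicOpen₁ V c hc j l m⟩ δjlm =
      disc halg hJ V c hc r hr hkr ψ hψ j l m)
    {δjln : Derivation A' (B ((V j).1 ⊓ (V l).1 ⊓ (V n).1)) (B ((V j).1 ⊓ (V l).1 ⊓ (V n).1) ⊗[A'] ↥J)}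
    (hδjln : readingAut halg hJ V r hr hkr 𝔪 π hπ h𝔪J hJ𝔪 j (inf_le_left.trans inf_le_left) ⟨_, inf₃_eq_basicOpen₁ V c hc j l n⟩ δjln =
      disc halg hJ V c hc r hr hkr ψ hψ j l n)
    {δjmn : Derivation A' (B ((V j).1 ⊓ (V m).1 ⊓ (V n).1)) (B ((V j).1 ⊓ (V m).1 ⊓ (V n).1) ⊗[A'] ↥J)}
    (hδjmn : readingAut halg hJ V r hr hkr 𝔪 π hπ h𝔪J hJ𝔪 j (inf_le_left.trans inf_le_left) ⟨_, inf₃_eq_basicOpen₁ V c hc j m n⟩ δjmn =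
      disc halg hJ V c hc r hr hkr ψ hψ j m n)
    {δlmn : Derivation A' (B ((V l).1 ⊓ (V m).1 ⊓ (V n).1)) (B ((V l).1 ⊓ (V m).1 ⊓ (V n).1) ⊗[A'] ↥J)}
    (hδlmn : readingAut halg hJ V r hr hkr 𝔪 π hπ h𝔪J hJ𝔪 l (inf_le_left.trans inf_le_left) ⟨_, inf₃_eq_basicOpen₁ V c hc l m n⟩ δlmn =
      disc halg hJ V c hc r hr hkr ψ hψ l m n)
    {εjlm εjln εjmn εlmn : Derivation A' (B ((V j).1 ⊓ (V l).1 ⊓ (V m).1 ⊓ (V n).1))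
      (B ((V j).1 ⊓ (V l).1 ⊓ (V m).1 ⊓ (V n).1) ⊗[A'] ↥J)}
    (hεjlm : ∀ x, εjlm (g h₄jlm x) = LinearMap.rTensor ↥J (g h₄jlm).toLinearMap (δjlm x))
    (hεjln : ∀ x, εjln (g h₄jln x) = LinearMap.rTensor ↥J (g h₄jln).toLinearMap (δjln x))
    (hεjmn : ∀ x, εjmn (g h₄jmn x) = LinearMap.rTensor ↥J (g h₄jmn).toLinearMap (δjmn x))
    (hεlmn : ∀ x, εlmn (g h₄lmn x) = LinearMap.rTensor ↥J (g h₄lmn).toLinearMap (δlmn x)) :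
    εlmn - εjmn + εjln - εjlm = 0 := by
  haveI hflat : ∀ (a : ι) (W : X₀.Opens) (h : W ≤ (V a).1), Module.Flat A' (chartLift V r a h) :=
    fun a W h => CanonicalLiftQuot.flat (r a) (res h)
  -- `W₄` is principal in each of the four charts
  have eql : (V j).1 ⊓ (V l).1 ⊓ (V m).1 ⊓ (V n).1 = X₀.basicOpen (c l j * c l m * c l n) := by
    rw [← inf₄_eq_basicOpen V c hc l j m n]; ac_rfl
  have eqm : (V j).1 ⊓ (V l).1 ⊓ (V m).1 ⊓ (V n).1 = X₀.basicOpen (c m j * c m l * c m n) := by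
    rw [← inf₄_eq_basicOpen V c hc m j l n]; ac_rfl
  have eqn : (V j).1 ⊓ (V l).1 ⊓ (V m).1 ⊓ (V n).1 = X₀.basicOpen (c n j * c n l * c n m) := by
    rw [← inf₄_eq_basicOpen V c hc n j l m]; ac_rfl
  have pj₄ : ∃ q : Γ(X₀, (V j).1), (V j).1 ⊓ (V l).1 ⊓ (V m).1 ⊓ (V n).1 = X₀.basicOpen q := ⟨_, inf₄_eq_basicOpen V c hc j l m n⟩
  have pl₄ : ∃ q : Γ(X₀, (V l).1), (V j).1 ⊓ (V l).1 ⊓ (V m).1 ⊓ (V n).1 = X₀.basicOpen q := ⟨_, eql⟩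
  have pm₄ : ∃ q : Γ(X₀, (V m).1), (V j).1 ⊓ (V l).1 ⊓ (V m).1 ⊓ (V n).1 = X₀.basicOpen q := ⟨_, eqm⟩
  have pn₄ : ∃ q : Γ(X₀, (V n).1), (V j).1 ⊓ (V l).1 ⊓ (V m).1 ⊓ (V n).1 = X₀.basicOpen q := ⟨_, eqn⟩
  -- the four `ε`'s ARE the readings of the restricted gluings on `W₄`
  have rjlm := reading_of_square halg hJ V c hc r hr hkr ψ hψ 𝔪 h𝔪J hJ𝔪 π hπ g hg j l m _ hj₄ hl₄ hm₄ h₄jlm pj₄ pl₄ pm₄ hδjlm hεjlm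
  have rjln := reading_of_square halg hJ V c hc r hr hkr ψ hψ 𝔪 h𝔪J hJ𝔪 π hπ g hg j l n _ hj₄ hl₄ hn₄ h₄jln pj₄ pl₄ pn₄ hδjln hεjln
  have rjmn := reading_of_square halg hJ V c hc r hr hkr ψ hψ 𝔪 h𝔪J hJ𝔪 π hπ g hg j m n _ hj₄ hm₄ hn₄ h₄jmn pj₄ pm₄ pn₄ hδjmn hεjmn
  have rlmn := reading_of_square halg hJ V c hc r hr hkr ψ hψ 𝔪 h𝔪J hJ𝔪 π hπ g hg l m n _ hl₄ hm₄ hn₄ h₄lmn pl₄ pm₄ pn₄ hδlmn hεlmn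
  -- ★ (U-coc) `reading_cocycle` for the four chart lifts on `W₄` and the six canonically restricted gluings
  exact reading_cocycle 𝔪 J h𝔪J hJ𝔪 (fibreRed halg V r π j hj₄) (fibreRed_surjective halg hJ V r hr hkr 𝔪 π hπ j hj₄ pj₄)
    (ker_fibreRed halg hJ V r hr hkr 𝔪 π hπ hJ𝔪 j hj₄ pj₄) (fibreRed halg V r π l hl₄) (fibreRed_surjective halg hJ V r hr hkr 𝔪 π hπ l hl₄ pl₄)
    (ker_fibreRed halg hJ V r hr hkr 𝔪 π hπ hJ𝔪 l hl₄ pl₄)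
    (fun x => fibreRed_gluingOn halg hJ V r hr hkr ψ hψ π j l _ hj₄ hl₄ pj₄ pl₄ x) rjlm rjln rjmn rlmn

end Atlas

end Literature.AlgebraicGeometry.Deformation.AtlasQuot

end
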